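/-
Copyright (c) 2026 the pub-hodgecm-mathlib formalisation cell (harness21).  Prover seat hodgecm-mathlib-F0P3a-p07 (g12), 2026-09-01.  Road «S3-ram» seeding wave (LEAD T11-41; owner F0P3a-p06 (g15)):
organ «(δ) tame-ram twin», FILE 1 of 2 — the line strata of `N₂ ∩ K₂` at a TAME-RAMIFIED non-split place.
-/
import Literature.NumberTheory.Automorphic.LineStrataMeasure                                      -- ★ p846593 (this seat): line algebra at `w` (place-generic: `hw` only)
import Literature.NumberTheory.Automorphic.Liu2021.LemD1AsPrintedIndexedNonVacuityRamifiedConverse    -- ★ `valued_galAdicCompletionMap_sub_lt_one_of_ramified` (`σ_w ≡ id mod 𝔪_w` at a ramified place)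
import Literature.NumberTheory.Automorphic.AnisotropicUnitaryGroupCompactOfPlace                    -- ★ `conjLocal_apply_eq_of_smul_eq` (`(σ y)_w = σ_w y_w` at a non-split place)
import HarnessLib

/-!
# The residual rank strata of the line unipotent group `N₂ ∩ K₂` at a TAME-RAMIFIED non-split place: the rank-`1` stratum is EMPTY

Topic `NumberTheory/Automorphic`; namespace `Literature.NumberTheory.Automorphic.UnitaryGroup`.  KERNEL MATHEMATICS ONLY: theorems, no definition, no named fact, no `sorry`, no instance, no
notation.  Cell `pub/hodgecm-mathlib`, crux H413 = `stmt-HodgeConjecture-24833`; road «S3-ram» seeding wave (LEAD F0P3a-plan (g12) T11-41; owner∕table F0P3a-p06 (g15) `S3RAM-ORGANS.md`), organ **«(δ) TAME-RAM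
TWIN», FILE 1** (seat F0P3a-p07 (g12)); the ramified twin of ★ `LineStrataMeasure` (p846593).  HONEST LABEL: HC_CM is proved only modulo the cell's 2 remaining named inputs (hLiu418 24832, h413 24833) until
rung 0 closes; «S3-ram» is Literature seeding with no books consequence; this file discharges nothing by itself.

THE MATHEMATICS ([Rogawski1990] §1.10 p. 9, §4.9 p. 54; [Serre1979] Ch. I §7–§8).  `L` CM, `v` a finite place of `L⁺` NON-SPLIT (`w ∣ v`, `c • w = w`) and RAMIFIED in `L` (`e(w|v) ≠ 1`), with `|2|_w = 1`.
Then `σ_w` acts trivially on the residue field: `|σ_w x − x|_w < 1` for `|x|_w ≤ 1` (★ `valued_galAdicCompletionMap_sub_lt_one_of_ramified`).  For a SKEW integral element `y` (`σy = −y`, `|y_w| ≤ 1`) this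
reads `|−2y_w|_w < 1`, i.e. **`|y_w| < 1`: the integral skew line is contained in `𝔪_w`** (`𝒪⁻ = 𝒪_v·ϖ` with `σϖ = −ϖ`).  Hence for every `n = [[1, y], [0, 1]] ∈ N₂ ∩ K₂` the reduction is
`red(n_w) = 1`, `rank(red(n_w) − 1) = 0` (★ FILE 1 `rank_redMat_unipotent_sub_one_eq_zero_iff`): **the rank-`1` stratum `S₁` of `N₂ ∩ K₂` is EMPTY and `S₀ = N₂ ∩ K₂`** — in place of the inert ratios
`(q − 1, 1)∕q` (★ `measureReal_lineStratum_one ∕ _zero`).  Consequently (FILE 2) the Levi H-values at a ramified place are `Φ_H(⟦(t,u)⟧, χ₀) = ν_H(K_H)·J_H(t)` and `Φ_H(⟦(t,u)⟧, χ₁) = 0`.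
* `valued_skew_apply_lt_one_of_ramified` (the finding), `rank_redMat_unipotent_sub_one_eq_zero_of_ramified`, `lineStratum_one_eq_empty_of_ramified`, `lineStratum_zero_eq_of_ramified`,
  `measureReal_lineStratum_one_of_ramified` (`= 0`), `measureReal_lineStratum_zero_of_ramified` (`= μ.real(N₂ ∩ K₂)`) — every measure `μ` (no Haar hypothesis needed).

## References
* [Rogawski1990] J. D. Rogawski, *Automorphic Representations of Unitary Groups in Three Variables*, Ann. of Math. Stud. 123 (1990), §1.10 p. 9; §4.9 p. 54.
* [Serre1979] J.-P. Serre, *Local Fields*, GTM 67 (1979), Ch. I §7–§8 (ramification; tame inertia acts trivially on the residue field).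
* [Kottwitz1986] R. E. Kottwitz, *Base change for unit elements of Hecke algebras*, Compositio Math. 60 (1986), §3.
-/

set_option autoImplicit false

noncomputable section

open MeasureTheory Measure Set Filter Topology NumberField IsDedekindDomain Matrix ValuativeRel
open scoped ENNReal NNReal ValuativeRel Matrix MatrixGroups

namespace Literature.NumberTheory.Automorphic.UnitaryGroup

open Literature.NumberTheory.Automorphic Literature.NumberTheory.Automorphic.IntegralReduction
open Literature.NumberTheory.Automorphic.UnitaryGroup.HeisRing Literature.NumberTheory.Automorphic.UnitaryGroup.LineRing
open Literature.NumberTheory.Automorphic.Liu2021.LemD1IndexedNonVacuityRamifiedConverse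

variable (L : Type) [Field L] [NumberField L] [IsCMField L] (v : HeightOneSpectrum (𝓞 ↥(maximalRealSubfield L)))
  (w : PlacesOver L v) (hw : IsCMField.complexConj L • w.1 = w.1)

include hw in
/-- **THE INTEGRAL SKEW LINE LIES IN `𝔪_w` AT A RAMIFIED PLACE**: for `y ∈ R⁻` (`σy = −y`) with `|y_w| ≤ 1`, `|y_w| < 1` — since `σ_w ≡ id (mod 𝔪_w)` at a ramified `w`
(★ `valued_galAdicCompletionMap_sub_lt_one_of_ramified`) gives `|σ_w y_w − y_w| = |2y_w| < 1` and `|2|_w = 1`. [cite: Serre1979, Ch. I §7–§8] [cite: Rogawski1990, §1.10 p. 9] -/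
theorem valued_skew_apply_lt_one_of_ramified (he : v.asIdeal.ramificationIdx' w.1.asIdeal ≠ 1) (h2w : Valued.v (2 : w.1.adicCompletion L) = 1)
    (y : ↥(HeisRing.skewPart (conjLocal L (IsCMField.complexConj L) v))) (hy : Valued.v ((y : LocalRing L v) w) ≤ 1) :
    Valued.v ((y : LocalRing L v) w) < 1 := by
  haveI : Algebra.IsQuadraticExtension ↥(maximalRealSubfield L) L := IsCMField.isQuadraticExtension L
  have hσ : galAdicCompletionMap (L := L) (IsCMField.complexConj L) hw ((y : LocalRing L v) w) = -((y : LocalRing L v) w) := by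
    rw [← conjLocal_apply_eq_of_smul_eq (IsCMField.complexConj L) (IsCMField.complexConj_ne_one L) v w hw, (mem_skewPart_iff _ _).1 y.2, Pi.neg_apply]
  have h := valued_galAdicCompletionMap_sub_lt_one_of_ramified L (IsCMField.complexConj L) v (IsCMField.complexConj_ne_one L) w hw he _ hy
  rw [hσ, show -((y : LocalRing L v) w) - (y : LocalRing L v) w = -(2 * (y : LocalRing L v) w) by ring, Valuation.map_neg, map_mul, h2w, one_mul] at h
  exact h

include hw in
/-- **AT A RAMIFIED PLACE EVERY `n ∈ N₂ ∩ K₂` HAS `rank(red(n_w) − 1) = 0`** (`n = [[1, y], [0, 1]]`, `y ∈ 𝒪⁻ ⊆ 𝔪_w`, ★ FILE 1 `rank_redMat_unipotent_sub_one_eq_zero_iff`).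
[cite: Rogawski1990, §4.9 p. 54] [cite: Kottwitz1986, §3] -/
theorem rank_redMat_unipotent_sub_one_eq_zero_of_ramified (he : v.asIdeal.ramificationIdx' w.1.asIdeal ≠ 1) (h2w : Valued.v (2 : w.1.adicCompletion L) = 1)
    (n : ↥(cmBorelTriple L 2 v).N) (hn : (n : ↥(unitaryGroupOfForm (conjLocal L (IsCMField.complexConj L) v) (cmLocalForm L 2 v))) ∈ cmLocalIntegralLevel L 2 (Matrix.of fun i j : Fin 2 => if i.val + j.val + 1 = 2 then (1 : L) else 0) v) :
    (redMat ((((n : ↥(unitaryGroupOfForm (conjLocal L (IsCMField.complexConj L) v) (cmLocalForm L 2 v))) : GL (Fin 2) (LocalRing L v)).val.map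
            (Pi.evalRingHom (fun w' : PlacesOver L v => w'.1.adicCompletion L) w))) - 1).rank = 0 := by
  have hle := (unipotent_mem_cmLocalIntegralLevel_iff L v w hw n).1 hn
  have hlt := valued_skew_apply_lt_one_of_ramified L v w hw he h2w
    ⟨_, umat_zero_one_mem_skewPart (conjLocal L (IsCMField.complexConj L) v) (cmLocalForm_eq_over L 2 v) n⟩ hle
  exact (rank_redMat_unipotent_sub_one_eq_zero_iff L v w n hle).2 hlt

include hw in
/-- **THE RANK-1 LINE STRATUM IS EMPTY AT A RAMIFIED PLACE.** [cite: Rogawski1990, §4.9 p. 54] [cite: Kottwitz1986, §3] -/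
theorem lineStratum_one_eq_empty_of_ramified (he : v.asIdeal.ramificationIdx' w.1.asIdeal ≠ 1) (h2w : Valued.v (2 : w.1.adicCompletion L) = 1) :
    {n : ↥(cmBorelTriple L 2 v).N | (n : ↥(unitaryGroupOfForm (conjLocal L (IsCMField.complexConj L) v) (cmLocalForm L 2 v))) ∈
          cmLocalIntegralLevel L 2 (Matrix.of fun i j : Fin 2 => if i.val + j.val + 1 = 2 then (1 : L) else 0) v ∧
        ((redMat ((((n : ↥(unitaryGroupOfForm (conjLocal L (IsCMField.complexConj L) v) (cmLocalForm L 2 v))) : GL (Fin 2) (LocalRing L v)).val.map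
            (Pi.evalRingHom (fun w' : PlacesOver L v => w'.1.adicCompletion L) w))) - 1) ^ 2 = 0 ∧
          (redMat ((((n : ↥(unitaryGroupOfForm (conjLocal L (IsCMField.complexConj L) v) (cmLocalForm L 2 v))) : GL (Fin 2) (LocalRing L v)).val.map
            (Pi.evalRingHom (fun w' : PlacesOver L v => w'.1.adicCompletion L) w))) - 1).rank = 1)} = ∅ := by
  ext n
  simp only [Set.mem_setOf_eq, Set.mem_empty_iff_false, iff_false, not_and]
  intro hn _ h1
  rw [rank_redMat_unipotent_sub_one_eq_zero_of_ramified L v w hw he h2w n hn] at h1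
  exact zero_ne_one h1

include hw in
/-- **THE RANK-0 LINE STRATUM IS ALL OF `N₂ ∩ K₂` AT A RAMIFIED PLACE** (`(red(n_w) − 1)² = 0` holds for every `n`, ★ FILE 1 `sq_redMat_unipotent_sub_one`). [cite: Rogawski1990, §4.9 p. 54] [cite: Kottwitz1986, §3] -/
theorem lineStratum_zero_eq_of_ramified (he : v.asIdeal.ramificationIdx' w.1.asIdeal ≠ 1) (h2w : Valued.v (2 : w.1.adicCompletion L) = 1) :
    {n : ↥(cmBorelTriple L 2 v).N | (n : ↥(unitaryGroupOfForm (conjLocal L (IsCMField.complexConj L) v) (cmLocalForm L 2 v))) ∈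
          cmLocalIntegralLevel L 2 (Matrix.of fun i j : Fin 2 => if i.val + j.val + 1 = 2 then (1 : L) else 0) v ∧
        ((redMat ((((n : ↥(unitaryGroupOfForm (conjLocal L (IsCMField.complexConj L) v) (cmLocalForm L 2 v))) : GL (Fin 2) (LocalRing L v)).val.map
            (Pi.evalRingHom (fun w' : PlacesOver L v => w'.1.adicCompletion L) w))) - 1) ^ 2 = 0 ∧
          (redMat ((((n : ↥(unitaryGroupOfForm (conjLocal L (IsCMField.complexConj L) v) (cmLocalForm L 2 v))) : GL (Fin 2) (LocalRing L v)).val.map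
            (Pi.evalRingHom (fun w' : PlacesOver L v => w'.1.adicCompletion L) w))) - 1).rank = 0)} =
      {n : ↥(cmBorelTriple L 2 v).N | (n : ↥(unitaryGroupOfForm (conjLocal L (IsCMField.complexConj L) v) (cmLocalForm L 2 v))) ∈
          cmLocalIntegralLevel L 2 (Matrix.of fun i j : Fin 2 => if i.val + j.val + 1 = 2 then (1 : L) else 0) v} := by
  ext n
  simp only [Set.mem_setOf_eq]
  exact ⟨fun h => h.1, fun hn => ⟨hn, sq_redMat_unipotent_sub_one L v w n, rank_redMat_unipotent_sub_one_eq_zero_of_ramified L v w hw he h2w n hn⟩⟩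

include hw in
/-- **RANK 1 LINE STRATUM AT A RAMIFIED PLACE: measure `0`** (the set is empty), for EVERY measure on `N₂`. [cite: Rogawski1990, §4.9 p. 54] -/
theorem measureReal_lineStratum_one_of_ramified [MeasurableSpace ↥(cmBorelTriple L 2 v).N] (μN : Measure ↥(cmBorelTriple L 2 v).N)
    (he : v.asIdeal.ramificationIdx' w.1.asIdeal ≠ 1) (h2w : Valued.v (2 : w.1.adicCompletion L) = 1) :
    μN.real {n : ↥(cmBorelTriple L 2 v).N | (n : ↥(unitaryGroupOfForm (conjLocal L (IsCMField.complexConj L) v) (cmLocalForm L 2 v))) ∈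
          cmLocalIntegralLevel L 2 (Matrix.of fun i j : Fin 2 => if i.val + j.val + 1 = 2 then (1 : L) else 0) v ∧
        ((redMat ((((n : ↥(unitaryGroupOfForm (conjLocal L (IsCMField.complexConj L) v) (cmLocalForm L 2 v))) : GL (Fin 2) (LocalRing L v)).val.map
            (Pi.evalRingHom (fun w' : PlacesOver L v => w'.1.adicCompletion L) w))) - 1) ^ 2 = 0 ∧
          (redMat ((((n : ↥(unitaryGroupOfForm (conjLocal L (IsCMField.complexConj L) v) (cmLocalForm L 2 v))) : GL (Fin 2) (LocalRing L v)).val.map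
            (Pi.evalRingHom (fun w' : PlacesOver L v => w'.1.adicCompletion L) w))) - 1).rank = 1)} = 0 := by
  rw [lineStratum_one_eq_empty_of_ramified L v w hw he h2w, measureReal_empty]

include hw in
/-- **RANK 0 LINE STRATUM AT A RAMIFIED PLACE: the whole of `N₂ ∩ K₂`**, for EVERY measure on `N₂` (inert twin: `q⁻¹·μ(N₂ ∩ K₂)`, ★ `measureReal_lineStratum_zero`).
[cite: Rogawski1990, §4.9 p. 54] -/
theorem measureReal_lineStratum_zero_of_ramified [MeasurableSpace ↥(cmBorelTriple L 2 v).N] (μN : Measure ↥(cmBorelTriple L 2 v).N)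
    (he : v.asIdeal.ramificationIdx' w.1.asIdeal ≠ 1) (h2w : Valued.v (2 : w.1.adicCompletion L) = 1) :
    μN.real {n : ↥(cmBorelTriple L 2 v).N | (n : ↥(unitaryGroupOfForm (conjLocal L (IsCMField.complexConj L) v) (cmLocalForm L 2 v))) ∈
          cmLocalIntegralLevel L 2 (Matrix.of fun i j : Fin 2 => if i.val + j.val + 1 = 2 then (1 : L) else 0) v ∧
        ((redMat ((((n : ↥(unitaryGroupOfForm (conjLocal L (IsCMField.complexConj L) v) (cmLocalForm L 2 v))) : GL (Fin 2) (LocalRing L v)).val.map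
            (Pi.evalRingHom (fun w' : PlacesOver L v => w'.1.adicCompletion L) w))) - 1) ^ 2 = 0 ∧
          (redMat ((((n : ↥(unitaryGroupOfForm (conjLocal L (IsCMField.complexConj L) v) (cmLocalForm L 2 v))) : GL (Fin 2) (LocalRing L v)).val.map
            (Pi.evalRingHom (fun w' : PlacesOver L v => w'.1.adicCompletion L) w))) - 1).rank = 0)} =
      μN.real {n : ↥(cmBorelTriple L 2 v).N | (n : ↥(unitaryGroupOfForm (conjLocal L (IsCMField.complexConj L) v) (cmLocalForm L 2 v))) ∈
          cmLocalIntegralLevel L 2 (Matrix.of fun i j : Fin 2 => if i.val + j.val + 1 = 2 then (1 : L) else 0) v} := by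
  rw [lineStratum_zero_eq_of_ramified L v w hw he h2w]

end Literature.NumberTheory.Automorphic.UnitaryGroup

end
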